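import Summits.QuantumFields.GaugeBoot.TiltedBoxLimitClass
import Summits.QuantumFields.GaugeBoot.TiltedBoxLimitDLR
import Literature.MathematicalPhysics.QuantumLattice.GaugeGroups
import HarnessLib

/-!
# Infinite-volume limit points of the 45°-tilted boxes, part 11: the venture's gauge groups `SU(N)`, `U(N)`

HONEST FRAMING (cell `pub-gaugeboot`, page 1 of every file): the venture produces certified bounds
on lattice expectations at stated coupling, gauge group, dimension and torus size; NOT a mass gap,
NOT a continuum limit, NOT a string tension; NOT Yang–Mills-summit-bearing (barriers
`FixedCouplingUltralocality`, `PerturbativeInvisibility`). Instances of parts 1–10 for the venture's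
own gauge groups, so that the class statements are visibly non-vacuous there; nothing else is claimed.

## Content

For `G = SU(N)` with its defining representation `fundamentalRep (Fin N)` and for `G = U(N)` with
`unitaryFundamentalRep (Fin N) ℂ`, every dimension `d`, every pair of axes `i ≠ j` and every
`β ≥ 0` (resp. every real `β` where no positivity is involved):

* `tiltedBoxLimitPoints_nonempty_suN / _uN` — tilted limit points exist;
* **`nonempty_tiltedClassState_suN / _uN`** — Class T (`TiltedClassState`: translation/(i j)/flip
  invariance, Haar-shift loop equations, `R_diag(i,j)`, `R_site(k)`, `R_link(k)` for `k ∉ {i, j}`)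
  is INHABITED — unconditionally, at every coupling, in particular for `SU(2)`, `SU(3)` in `d = 4`
  at weak coupling, where inhabitation of `ClassBState` is open (tribunal R8);
* `mem_ymGibbsMeasuresTI_suN` — tilted limit points of `SU(N)` are translation-invariant DLR states;
* **`thermodynamicLimitIsClassB_suN_of_subsingleton_TI / _uN_…`** — for `SU(N)` / `U(N)`,
  `ThermodynamicLimitIsClassB d ρ β` follows from uniqueness of the translation-invariant Gibbs state
  `|𝒢_θ(β)| ≤ 1` (`β ≥ 0`, `d ≥ 1`); the hypothesis is NOT discharged here.

References: J. Fröhlich, R. Israel, E. H. Lieb, B. Simon, J. Stat. Phys. 22 (1980) 297, §3;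
H.-O. Georgii, Gibbs Measures and Phase Transitions (2011) Thm. 4.17.
-/

noncomputable section

open MeasureTheory
open Literature.MathematicalPhysics.QuantumLattice

namespace Summit.QuantumFields.GaugeBoot

namespace TiltedRP

/-! ## `SU(N)` -/

section SpecialUnitary

variable {d N : ℕ} {i j : Fin d}

/-- **Tilted limit points of `SU(N)` lattice gauge theory exist** (every `d`, `i`, `j`, real `β`). -/
theorem tiltedBoxLimitPoints_nonempty_suN (β : ℝ) :
    (tiltedBoxLimitPoints d i j (fundamentalRep (Fin N)) β).Nonempty := by
  haveI : SecondCountableTopology (Matrix (Fin N) (Fin N) ℂ) :=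
    inferInstanceAs (SecondCountableTopology (Fin N → Fin N → ℂ))
  haveI : SecondCountableTopology (Matrix.specialUnitaryGroup (Fin N) ℂ) :=
    Topology.IsEmbedding.subtypeVal.secondCountableTopology
  exact tiltedBoxLimitPoints_nonempty (continuous_fundamentalRep (Fin N)) β

/-- **Class T is inhabited for `SU(N)`** at every `β ≥ 0`, in every dimension, for every pair of
axes `i ≠ j` — with a tilted limit point as witness. -/
theorem nonempty_tiltedClassState_suN (hij : i ≠ j) {β : ℝ} (hβ : 0 ≤ β) :
    Nonempty (TiltedClassState d i j (fundamentalRep (Fin N)) β) := by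
  haveI : SecondCountableTopology (Matrix (Fin N) (Fin N) ℂ) :=
    inferInstanceAs (SecondCountableTopology (Fin N → Fin N → ℂ))
  haveI : SecondCountableTopology (Matrix.specialUnitaryGroup (Fin N) ℂ) :=
    Topology.IsEmbedding.subtypeVal.secondCountableTopology
  exact nonempty_tiltedClassState (fundamentalRep (Fin N)) hij (continuous_fundamentalRep (Fin N)) hβ

/-- Tilted limit points of `SU(N)` are translation-invariant DLR states. -/
theorem mem_ymGibbsMeasuresTI_suN {β : ℝ}
    {μ : Measure (LGConfig d (Matrix.specialUnitaryGroup (Fin N) ℂ))}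
    (hμ : μ ∈ tiltedBoxLimitPoints d i j (fundamentalRep (Fin N)) β) :
    μ ∈ ymGibbsMeasuresTI (fundamentalRep (Fin N)) β := by
  haveI : SecondCountableTopology (Matrix (Fin N) (Fin N) ℂ) :=
    inferInstanceAs (SecondCountableTopology (Fin N → Fin N → ℂ))
  haveI : SecondCountableTopology (Matrix.specialUnitaryGroup (Fin N) ℂ) :=
    Topology.IsEmbedding.subtypeVal.secondCountableTopology
  exact mem_ymGibbsMeasuresTI_of_mem_tiltedBoxLimitPoints (fundamentalRep (Fin N))
    (continuous_fundamentalRep (Fin N)) hμ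

/-- **`SU(N)`: Class B from uniqueness of the translation-invariant Gibbs state** (`β ≥ 0`,
`d ≥ 1`): `|𝒢_θ(β)| ≤ 1 → ThermodynamicLimitIsClassB d (fundamentalRep (Fin N)) β`. -/
theorem thermodynamicLimitIsClassB_suN_of_subsingleton_TI [NeZero d] {β : ℝ} (hβ : 0 ≤ β)
    (hsub : (ymGibbsMeasuresTI (d := d) (fundamentalRep (Fin N)) β).Subsingleton) :
    ThermodynamicLimitIsClassB d (fundamentalRep (Fin N)) β := by
  haveI : SecondCountableTopology (Matrix (Fin N) (Fin N) ℂ) :=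
    inferInstanceAs (SecondCountableTopology (Fin N → Fin N → ℂ))
  haveI : SecondCountableTopology (Matrix.specialUnitaryGroup (Fin N) ℂ) :=
    Topology.IsEmbedding.subtypeVal.secondCountableTopology
  exact thermodynamicLimitIsClassB_of_subsingleton_TI (fundamentalRep (Fin N))
    (continuous_fundamentalRep (Fin N)) hβ hsub

end SpecialUnitary

/-! ## `U(N)` -/

section Unitary

variable {d N : ℕ} {i j : Fin d}

/-- **Tilted limit points of `U(N)` lattice gauge theory exist.** -/
theorem tiltedBoxLimitPoints_nonempty_uN (β : ℝ) :
    (tiltedBoxLimitPoints d i j (unitaryFundamentalRep (Fin N) ℂ) β).Nonempty := by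
  haveI : SecondCountableTopology (Matrix (Fin N) (Fin N) ℂ) :=
    inferInstanceAs (SecondCountableTopology (Fin N → Fin N → ℂ))
  haveI : SecondCountableTopology (Matrix.unitaryGroup (Fin N) ℂ) :=
    Topology.IsEmbedding.subtypeVal.secondCountableTopology
  exact tiltedBoxLimitPoints_nonempty (continuous_unitaryFundamentalRep (n := Fin N) (𝕜 := ℂ)) β

/-- **Class T is inhabited for `U(N)`** at every `β ≥ 0`, every `d`, every `i ≠ j`. -/
theorem nonempty_tiltedClassState_uN (hij : i ≠ j) {β : ℝ} (hβ : 0 ≤ β) :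
    Nonempty (TiltedClassState d i j (unitaryFundamentalRep (Fin N) ℂ) β) := by
  haveI : SecondCountableTopology (Matrix (Fin N) (Fin N) ℂ) :=
    inferInstanceAs (SecondCountableTopology (Fin N → Fin N → ℂ))
  haveI : SecondCountableTopology (Matrix.unitaryGroup (Fin N) ℂ) :=
    Topology.IsEmbedding.subtypeVal.secondCountableTopology
  exact nonempty_tiltedClassState (unitaryFundamentalRep (Fin N) ℂ) hij
    (continuous_unitaryFundamentalRep (n := Fin N) (𝕜 := ℂ)) hβ

/-- **`U(N)`: Class B from uniqueness of the translation-invariant Gibbs state** (`β ≥ 0`, `d ≥ 1`). -/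
theorem thermodynamicLimitIsClassB_uN_of_subsingleton_TI [NeZero d] {β : ℝ} (hβ : 0 ≤ β)
    (hsub : (ymGibbsMeasuresTI (d := d) (unitaryFundamentalRep (Fin N) ℂ) β).Subsingleton) :
    ThermodynamicLimitIsClassB d (unitaryFundamentalRep (Fin N) ℂ) β := by
  haveI : SecondCountableTopology (Matrix (Fin N) (Fin N) ℂ) :=
    inferInstanceAs (SecondCountableTopology (Fin N → Fin N → ℂ))
  haveI : SecondCountableTopology (Matrix.unitaryGroup (Fin N) ℂ) :=
    Topology.IsEmbedding.subtypeVal.secondCountableTopology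
  exact thermodynamicLimitIsClassB_of_subsingleton_TI (unitaryFundamentalRep (Fin N) ℂ)
    (continuous_unitaryFundamentalRep (n := Fin N) (𝕜 := ℂ)) hβ hsub

end Unitary

end TiltedRP

end Summit.QuantumFields.GaugeBoot
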